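import Summits.ResolutionOfSingularities.ResolutionOfSingularities.Theorems.FrobeniusLadderFInjectiveMacaulayficationProp44SliceDimTwo
import Literature.AlgebraicGeometry.Resolution.GenericPointStalkData
import HarnessLib

/-!
# [CoP1] Prop. 4.4 (`CossartPiltant2008_prop44`, F-71), slice G5 at the fact's own quantifiers WITHOUT the colength / embedding-dimension
# bookkeeping: both follow from the fact's hypothesis «`V(J)` has codimension `≥ 2`» (referee R22, rider r1)

[L1 W4.5a · crux `FInjectiveMacaulayfication` (stmt-ResolutionOfSingularities-15315); D-0154 (2) RES inputs cell, seat res-inputs-p-8b.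
PROVED, fact-free, definition-free; nothing of the manuscript under adjudication is used.]

`orderReducible_of_finite_dimTwo` / `prop44_conclusion_of_finite_dimTwo` (`…Prop44SliceDimTwo.lean`, p615789) take, at each bad closed point
`x`, the embedding dimension `(maximalIdeal 𝒪_{X,x}).spanFinrank = 2` and the finiteness of the colength `λ(𝒪_{X,x}/J_x)` as hypotheses.
At the quantifiers of `CossartPiltant2008_prop44` both are consequences of data the fact already carries (res-inputs-crit-1, REFEREE R22 (r1)):
the stage is regular, so `spanFinrank 𝔪_x = dim 𝒪_{X,x} = coheight x` (`spanFinrank_maximalIdeal_stalk_eq`); and «`V(J)` has codimension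
`≥ 2`» (`∀ x ∈ V(J), 1 < coheight x`) makes a point of `V(J)` of coheight `2` a MAXIMAL point of `V(J)` (a proper generisation inside `V(J)`
would have coheight `≤ 1`), so `J_x` is `𝔪_x`-primary and the colength is finite (`isFiniteLength_quotient_stalkIdeal_of_mem_maxPoints`,
`GenericPointStalkData.lean`).

* `mem_maxPoints_support_of_coheight_eq_two` — codimension `≥ 2` + coheight `2` ⇒ maximal point of `V(J)`;
* `prop44_conclusion_of_finite_coheight_two` — **G5 at F-71's quantifiers**: `S` regular excellent integral Noetherian, `ρ : X → S` a
  Cossart–Piltant stage, `(J, μ)` with `μ ≥ 1`, `ord ≤ μ` everywhere, `V(J)` of codimension `≥ 2`, and every point of order `μ` in a finite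
  set of CLOSED points of coheight `2` ⊢ the conclusion of Prop. 4.4 (a permissible sequence with integral regular centres lowering the
  order below `μ`).

`CossartPiltant2008_prop44` itself is NOT proved; resolution in dimension `≥ 4` / positive characteristic is NOT proved. AI-written; AI review is
weaker than expert review.

## References
* V. Cossart, O. Piltant, J. Algebra 320 (2008), Prop. 4.4 and its proof, p. 10. [CossartPiltant2008]
* The Stacks Project, Tag 02IZ (dimension of local rings and codimension), Tag 01J7. [StacksProject]
-/

-- `Summit.<Summit>.<Sub>.Theorems` with `Sub = Summit` (single-conjunct summit, D-0017)
set_option linter.dupNamespace false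

noncomputable section

open CategoryTheory AlgebraicGeometry TopologicalSpace IsLocalRing
open Literature.AlgebraicGeometry.Resolution Scheme.IdealSheafData

namespace Summit.ResolutionOfSingularities.ResolutionOfSingularities.Theorems

namespace CP2008Prop44

universe u

/-- **Codimension `≥ 2` and coheight `2` ⇒ maximal point.** If every point of `V(J)` has coheight `> 1` (`V(J)` of codimension `≥ 2`,
the hypothesis of `CossartPiltant2008_prop44`) then a point `x ∈ V(J)` of coheight `2` is a maximal point of `V(J)`: a generisation
`η' ⤳ x` inside `V(J)` with `η' ≠ x` would have `coheight η' + 1 ≤ coheight x = 2`. [cite: StacksProject, Tag 02IZ] -/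
theorem mem_maxPoints_support_of_coheight_eq_two {X : Scheme.{u}} {J : X.IdealSheafData}
    (hcodim : ∀ x ∈ J.support, 1 < Order.coheight x) {x : X} (hx : x ∈ (J.support : Set X))
    (hcoh : Order.coheight x = 2) : x ∈ maxPoints (J.support : Set X) := by
  refine mem_maxPoints_iff.mpr ⟨hx, fun η' hη' hsp => ?_⟩
  by_contra hne
  have hlt : x < η' := lt_of_le_not_ge (Scheme.le_iff_specializes.mpr hsp) fun h' =>
    hne ((Specializes.antisymm (Scheme.le_iff_specializes.mp h') hsp).eq).symm
  have h1 : Order.coheight η' + 1 ≤ Order.coheight x := Order.coheight_add_one_le hlt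
  have h2 : (1 : ℕ∞) < Order.coheight η' := hcodim η' hη'
  rw [hcoh] at h1
  generalize hc : Order.coheight η' = c at h1 h2
  induction c using ENat.recTopCoe with
  | top => exact absurd h1 (by simp)
  | coe n =>
    have h1' : n + 1 ≤ 2 := by exact_mod_cast h1
    have h2' : 1 < n := by exact_mod_cast h2
    omega

/-- **G5 AT THE QUANTIFIERS OF `CossartPiltant2008_prop44` (bookkeeping-free form, referee R22 (r1)).** `S` regular, excellent, integral,
Noetherian; `ρ : X → S` a stage of a Cossart–Piltant sequence (`X` integral Noetherian); `(J, μ)` with `μ ≥ 1`, `ord_x J ≤ μ` everywhere and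
`V(J)` of codimension `≥ 2`; every point of order `μ` in a finite set `T` of CLOSED points of coheight `2` (local dimension `2` — possible only
over a non-Jacobson `S`). Then there is a permissible sequence for `(J, μ)` with integral regular centres inside `{ord = μ}` whose last weak
transform has order `< μ` everywhere. (Embedding dimension and finite colength at the points of `T` are DERIVED: regular stage,
`mem_maxPoints_support_of_coheight_eq_two`; then `prop44_conclusion_of_finite_dimTwo`.) [cite: CossartPiltant2008, Prop. 4.4 (proof, p. 10)] -/
theorem prop44_conclusion_of_finite_coheight_two (S : Scheme.{u}) [IsIntegral S] [IsNoetherian S]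
    (hS : Scheme.IsRegular S) (I : S.IdealSheafData)
    (X : Scheme.{u}) (ρ : X ⟶ S) [IsIntegral X] [IsNoetherian X] (hρ : IsRegularCentreBlowupSeq ρ I)
    (J : X.IdealSheafData) (μ : ℕ) (hμ : 1 ≤ μ) (hcodim : ∀ x ∈ J.support, 1 < Order.coheight x)
    (hle : ∀ x, idealOrder J x ≤ μ)
    (T : Set X) (hT : T.Finite) (hTc : ∀ x ∈ T, IsClosed ({x} : Set X))
    (hJT : ∀ x : X, (μ : ℕ∞) ≤ idealOrder J x → x ∈ T) (hord : ∀ x ∈ T, idealOrder J x = μ)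
    (hcoh : ∀ x ∈ T, Order.coheight x = 2) :
    ∃ (X' : Scheme.{u}) (π : X' ⟶ X) (J' : X'.IdealSheafData), IsPermissibleSeq π J μ J' ∧ ∀ x, idealOrder J' x < μ := by
  have hX : Scheme.IsRegular X := hρ.isRegular hS
  -- the points of `T` lie in `V(J)` (`ord = μ ≥ 1`)
  have hsupp : ∀ x ∈ T, x ∈ (J.support : Set X) := fun x hx => by
    rw [SetLike.mem_coe, ← one_le_idealOrder_iff]
    rw [hord x hx]
    exact_mod_cast hμ
  refine prop44_conclusion_of_finite_dimTwo S hS I X ρ hρ J μ hμ hle T hT hTc hJT hord (fun x hx => ?_) (fun x hx => ?_)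
  · haveI := hX x
    exact spanFinrank_maximalIdeal_stalk_eq x (hcoh x hx)
  · exact isFiniteLength_quotient_stalkIdeal_of_mem_maxPoints
      (mem_maxPoints_support_of_coheight_eq_two hcodim (hsupp x hx) (hcoh x hx))

end CP2008Prop44

end Summit.ResolutionOfSingularities.ResolutionOfSingularities.Theorems

end
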